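import Summits.QuantumFields.YangMills.Theorems.BalabanUVNodesN18AtRecord
import Summits.QuantumFields.BalabanUV.T4Continuum.Spine.NE5.EnvelopeOnRecordWitness
import Literature.MathematicalPhysics.QuantumFieldTheory.Balaban1983to89.Node00.Record11

/-!
# BalabanUVNodes ∕ node N18 = NE5 — THE H-LAYER END AT THE RATE CARRIERS: `N18At` and the K4 stub `S_N18 RRec` KNIT BY NAME from
# the `Spine/NE5/EnvelopeOnRecord*` faces on Bałaban's torus catalogue, with the NODE-A majorant ([II] Lemma 3 (2.38)) as HYPOTHESIS,
# refinement-generic in the rate-record predicate and keyed to the Stage-11 record's datum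

Cell `pub-ymgap`, HUMAN RULING D-0062 (Track A at full width), R134 acceleration seat `pub-ymgap-dag-n18-d` (strategy s2: by-name knit at
the ₁₁ record), generation 0.  THEOREMS ONLY (no `def`, no `def … : Prop`); imports the (W2) at-record module of N18
(`YangMills/Theorems/BalabanUVNodesN18AtRecord.lean`, seat n18-a p420131: `U3Carriers`, `N18At`, `S_N18`, `RateRecordPred` of the route's K4 tree-home
module `BalabanUVNodesSpineRates` and the closers `s_N18_of_refines ∕ _of_pinned`), the H-layer END of row NE5 on the CARRIERS OF RECORD
(`Spine/NE5/EnvelopeOnRecord.lean` p341430 through `Spine/NE5/EnvelopeOnRecordWitness.lean`: `ne5_of_leaves_fibre_activities_record_eps`,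
`eps_threshold_record`, `exists_end_fires`) and NODE 00's Stage-11 record (`Node00/Record11.lean` p444286: `IsRecordOfRecord₁₁C`,
`isDatumOfRecord₀_of_isRecordOfRecord₁₁C`); modifies nothing; every cited lemma is used BY NAME.  `--supports stmt-QuantumFields-19676` (K3
`SpineGivenEndpointR11`, director LINE №68).

WHY THIS FILE.  The (W2) closers of `BalabanUVNodesN18AtRecord` run through the PRIMITIVE-RATE END of the NE5 chain
(`N18Coherence.ne5_family_couplingReading_of_primitive_rate` over `TwoRunTorusNE5.torusCarriers`: one-run envelopes + a two-run rate `r_j ≤ C₂θ^j` +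
per-member pencil bounds).  Row NE5 has a SECOND END of record, the route-P1 «input-interpolation Cauchy rate» END with W2 := H-LAYER DATA on the
row's carriers of record `B13Carriers.TwoRuns.carriers` (`Dom = Σ j, 𝐃_j` = the torus catalogues `TDom 4 (R.cubesPerDir j)`, `scale = j`,
`d = torusTreeLen`, transport = one block averaging + level identification): `EnvelopeOnRecord.ne5_of_leaves_fibre_activities_record_eps` — from a step
model `M` whose output IS (2.13) of scale-`j` activities (`hrep`), the H-LAYER DATUM `hH` (near every admissible box an open set on which every
activity is ℂ-differentiable in the data and dominated by THE NODE-A MAJORANT `C₃ε₁·e^{−R_d·d_j(Z)}` of [Balaban1988RG2Cluster] Lemma 3 (2.38) —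
a HYPOTHESIS here, instanced by nobody), the leaves L01–L03 ∕ L05–L09unit of `Spine/NE5/LeafIndex`, the located numerals
`κ + 128·log 162 + 2 ≤ R_d`, `C₃ε₁·e^{5κ+1}·K₀(64,8)·576 ≤ 1`, the reach clause L10 and the sharp clause — concluding `T4OutputRate.NE5 EA EB W κ θ′ C₅`
with `C₅ = ((e·576·K₀(64,8)²·C₃ε₁∕(1−ρ₀))(δ+δ′) + B)(θ′−ω)∕(θ′ − (ω + e·576·K₀(64,8)²·C₃ε₁∕(1−ρ₀)·c_H))`.  That END had NO consumer under
`YangMills/Theorems/` or `Node00/`.  This file knits it to the route's N18 decl: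
* §1 `n18At_of_envelopeOnRecord` — `N18At ⟨R.carriers, W, γ, κ, EA, EB, θ′, C₅, …⟩` member by member (`b ∈ ]0, γ]`: per-member step model `M b` and
  activities `act b`, run A's functional and the letters common), ONE `θ′`, ONE `C₅`; `n18At_of_envelopeOnRecord_eps` — both W2 clauses as ONE
  ε₁-threshold (`eps_threshold_record`): for every `ε₁ ∈ [0, ε⋆[` and every member data at majorant `C₃ε₁`, `N18At` with `C₅(ε₁)`;
  `n18At_comap` — `N18At` pulls back along maps of carriers preserving scale ∕ tree length and commuting with the transports
  (`N18Knit.ne5_family_comap`): how a home whose U3 carriers re-index `TwoRuns.carriers` (e.g. a level of `Spine/NE9/TowerCarriers.TowerData`)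
  still takes N18 from this END.
* §2 `s_N18_of_comap` — `S_N18 RRec` for EVERY `RRec : RateRecordPred N` whose bundles read, through such maps, a bundle carrying `N18At`
  (carrier-generic closer); `s_N18_of_envelopeOnRecord` — `S_N18 RRec` for every `RRec` whose bundles of record carry the slot «`R.u3` IS such an
  H-layer bundle with its data» (the refinement-generic shape of n18-a's `s_N18_of_primitiveRate`; ONE application at a rate-record home).
* §3 THE DATUM KEY (strategy s2 «at ₁₁»): `s_N18_datum_of_envelopeOnRecord` — the same with the two-run datum BUILT FROM THE RECORD's DATUM,
  `⟨F, K, m′, D.av (K+1) 0, admA, admB, hmaps⟩ : TwoRuns (SU N)` (run B → run A transport := the datum's OWN level-0 averaging of the `(K+1)`-st torus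
  + `T4LevelShift.fieldShift`); `datumCarriers_transport_of_isRecordOfRecord₁₁C` — at a Stage-11 record `Node00.IsRecordOfRecord₁₁C F N D w` that
  transport IS Bałaban's printed (0.4) block averaging `transportRaw F K (blockAvg expMeanLogSU)` (the record pins the averaging at Stage 0).
* §4 `n18At_envelopeOnRecord_fires` — INHABITED-WITH-CONTENT rider: on EVERY `R`, window, `κ ≥ 0`, `θ′ ∈ ]½, 1]`, the §1 bundle shape holds for the
  recursively defined outputs of the witness model `EnvelopeOnRecordWitness.wModel` with POSITIVE activity ∕ separation ∕ gain letters
  (`exists_end_fires` + `N18AtByName.n18At_of_ne5`): the END's binder list has no hidden clash at the `N18At` level either.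
HONEST FRAMING.  Kernel bookkeeping BY NAME; 0 sorry; restates nothing.  NE5 is NOT IN PRINT ([Balaban1987RG1] Thm 1 p. 259: uniformity in ε
only; GAPS G-t4-U3-1) and NOT PROVED; the H-layer datum `hH` (NODE A's (2.38) majorant for Bałaban's ACTUAL (2.14)-term activities, holomorphic on
the (2.16)–(2.18) class) and the leaves on Bałaban's objects are instanced by NOBODY (0∕12 leaves); NO `Node00/` rate-record home `RRec` has landed
(FAN-OUT v1.1 §N18 «Definition waited on»), so the one-application instancing of §2∕§3 is LOCATED, not performed ⇒ NOTHING here is a discharge of N18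
and the count does not move (typed 28∕28 · discharged 5∕28).  One finite four-torus at fixed ε; NOT infinite volume, NOT OS on ℝ⁴, NOT a mass gap,
NOT Clay.
-/

noncomputable section

open Set Metric

namespace YMDAG.N18.HLayer

open Literature.MathematicalPhysics.QuantumFieldTheory.Balaban1983to89
open Literature.MathematicalPhysics.QuantumFieldTheory.Balaban1983to89.T4Continuum
open Literature.MathematicalPhysics.QuantumFieldTheory.Balaban1983to89.T4OutputRate (Carriers Functional NE5)
open Literature.MathematicalPhysics.QuantumFieldTheory.Balaban1983to89.T4InputCauchyRateData (StepModel)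
open Literature.MathematicalPhysics.QuantumFieldTheory.Balaban1983to89.B13Resummation (locE)
open Literature.MathematicalPhysics.QuantumFieldTheory.Balaban1983to89.TreeLengthTorus (TDom tsys torusTreeLen)
open Literature.MathematicalPhysics.QuantumFieldTheory.Balaban1983to89.TreeLengthTorusGeometry (TTouch)
open Literature.MathematicalPhysics.QuantumFieldTheory.Balaban1983to89.B12TreeDecay (K₀)
open Summit.QuantumFields.BalabanUV.T4Continuum.B13Carriers (TwoRuns transportRaw)
open Summit.QuantumFields.BalabanUV.T4Continuum.StepRecursion (recA recB)
open Summit.QuantumFields.BalabanUV.T4Continuum.Spine.NE5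
open Summit.QuantumFields.BalabanUV.T4Continuum.Spine.NE5.EnvelopeOnRecordWitness (wModel exists_end_fires)
open Summit.QuantumFields.YangMills.BalabanUVNodes.N18Knit (ne5_family_comap)
open Summit.QuantumFields.YangMills.BalabanUVNodes.N18AtByName (n18At_of_ne5)
open YMDAG.UVSplit

/-! ## §1 `N18At` at the H-layer bundle on the carriers of record, member by member -/

section Face

variable {G : Type} [GaugeGroup G] (Rr : TwoRuns G)
variable {Op Hist : Type*} [NormedAddCommGroup Op] [NormedSpace ℂ Op] [NormedAddCommGroup Hist] [NormedSpace ℂ Hist]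
-- decidability instances as BINDERS (they unify with any consumer's; `Spine/NE5/EnvelopeOnRecord` TECHNICAL NOTE)
variable [∀ j, DecidableEq (TDom 4 (Rr.cubesPerDir j))] [∀ j, DecidableRel (TTouch (d := 4) (N := Rr.cubesPerDir j))]

/-- **N18 AT THE H-LAYER BUNDLE ON THE CARRIERS OF RECORD** [bookkeeping].  For a two-run datum `Rr` (torus family, `K`, `m′`, one block
averaging, admissible classes) and, for every member `b ∈ ]0, γ]` of run B's first-coupling family, a step model `M b` over `Rr.carriers` whose
output at `⟨j, X⟩` IS (2.13) of scale-`j` activities `act b j` (`hrep`) carrying THE NODE-A MAJORANT AS HYPOTHESIS (`hH`: near every admissible box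
an open set on which every activity is ℂ-differentiable in the data and `‖act b j z Z‖ ≤ C₃ε₁·e^{−R_d·d_j(Z)}` — [II] Lemma 3 (2.38), NOT instanced),
run A's functional `EA` and run B's family `EB b` represented by `M b` (L01 ∕ L02) with L03, the levels L05 ∕ L06, row NE2's rates L07 ∕ L08, the W3
shapes L09aff ∕ L09blind ∕ L09hom ∕ L09unit, and ONCE the located numerals, the [KP86] clause, the reach clause L10 and the sharp clause: the H-layer
END `EnvelopeOnRecord.ne5_of_leaves_fibre_activities_record_eps` BY NAME at each member gives `N18At` at the bundle
`⟨Rr.carriers, W, γ, κ, EA, EB, θ′, C₅, …⟩` with ONE `θ′` and ONE `C₅` (any NE9 ∕ read-out letters `Λ C₉ ωm cr ρ`).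
[cite: Balaban1988RG2Cluster, Lemma 3 (2.38) p.20 and (2.13) p.14; Balaban1987RG1, Thm 1 p.259] -/
theorem n18At_of_envelopeOnRecord (M : ℝ → StepModel Rr.carriers Op Hist)
    {act : ℝ → (j : ℕ) → Op × Hist → TDom 4 (Rr.cubesPerDir j) → ℂ} {W : Set (ℕ → ℝ)} {γ C3 ε₁ Rd κ : ℝ}
    {EA : Functional Rr.carriers Rr.carriers.BgA} {EB : ℝ → Functional Rr.carriers Rr.carriers.BgB}
    {EA₀ E₀ E₁ δ δ' θ θ' cH ω ρ₀ B : ℝ} {k₀ : ℕ}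
    (hrep : ∀ b : ℝ, 0 < b → b ≤ γ → ∀ (X : Rr.carriers.Dom) (z : Op × Hist),
      (M b).Out X.1 z.1 z.2 X =
        locE (TTouch (d := 4) (N := Rr.cubesPerDir X.1)) (fun Z : (tsys 4 (Rr.cubesPerDir X.1)).Dom => Z.1) (act b X.1 z) X.2.1)
    (hC3 : 0 ≤ C3) (hε₁ : 0 ≤ ε₁) (hκ : 0 ≤ κ) (hrate : κ + 2 * (64 * Real.log 162) + 2 ≤ Rd)
    (hKP : C3 * ε₁ * Real.exp (5 * κ + 1) * K₀ 64 8 * 9 * 64 ≤ 1)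
    (hH : ∀ b : ℝ, 0 < b → b ≤ γ → ∀ j, ∀ g ∈ W, ∀ (U : Rr.carriers.BgB) (p : Op × Hist), p ∈ (M b).Base j g U →
      ∃ V : Set (Op × Hist), IsOpen V ∧ (M b).box j p ⊆ V ∧
        (∀ Z : TDom 4 (Rr.cubesPerDir j), DifferentiableOn ℂ (fun z : Op × Hist => act b j z Z) V) ∧
        (∀ z ∈ V, ∀ Z : TDom 4 (Rr.cubesPerDir j), ‖act b j z Z‖ ≤ C3 * ε₁ * Real.exp (-(Rd * torusTreeLen Z.1))))
    (l01 : ∀ b : ℝ, 0 < b → b ≤ γ → L01 (M b) EA W) (l02 : ∀ b : ℝ, 0 < b → b ≤ γ → L02 (M b) (EB b) W)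
    (l03 : ∀ b : ℝ, 0 < b → b ≤ γ → L03 (M b) (EB b) W) (l05 : L05 EA W EA₀ κ)
    (l06 : ∀ b : ℝ, 0 < b → b ≤ γ → L06 (EB b) W E₀ κ) (l07 : ∀ b : ℝ, 0 < b → b ≤ γ → L07 (M b) W δ θ)
    (l08 : ∀ b : ℝ, 0 < b → b ≤ γ → L08 (M b) W κ E₀ δ' θ) (l09aff : ∀ b : ℝ, 0 < b → b ≤ γ → L09aff (M b) W)
    (l09blind : ∀ b : ℝ, 0 < b → b ≤ γ → L09blind (M b) W) (l09hom : ∀ b : ℝ, 0 < b → b ≤ γ → L09hom (M b) W)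
    (l09unit : ∀ b : ℝ, 0 < b → b ≤ γ → L09unit (M b) W κ E₁ cH ω)
    (hE₁ : 0 < E₁) (hδ : 0 ≤ δ + δ') (hθ : 0 ≤ θ) (hθθ' : θ ≤ θ') (hθ'1 : θ' ≤ 1) (hcH : 0 ≤ cH) (hω : 0 < ω) (hρ₀ : ρ₀ < 1)
    (l10near : (δ + δ') * θ ^ k₀ + cH * (EA₀ + E₀) / (1 - ω) ≤ ρ₀) (hB : 0 ≤ B) (l10first : ∀ k < k₀, EA₀ + E₀ ≤ B * θ ^ k)
    (hS : Real.exp 1 * 9 * 64 * K₀ 64 8 ^ 2 * C3 * cH * ε₁ < (θ' - ω) * (1 - ρ₀))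
    (Λ : ℕ → ℕ → ℝ) (C₉ ωm cr ρ : ℝ) :
    N18At ⟨Rr.carriers, W, γ, κ, EA, EB, θ',
      (Real.exp 1 * 9 * 64 * K₀ 64 8 ^ 2 * (C3 * ε₁) / (1 - ρ₀) * (δ + δ') + B) * (θ' - ω) /
        (θ' - (ω + Real.exp 1 * 9 * 64 * K₀ 64 8 ^ 2 * (C3 * ε₁) / (1 - ρ₀) * cH)), Λ, C₉, ωm, cr, ρ⟩ :=
  fun b hb hbγ =>
    ne5_of_leaves_fibre_activities_record_eps Rr (M b) (hrep b hb hbγ) hC3 hε₁ hκ hrate hKP (hH b hb hbγ) (l01 b hb hbγ)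
      (l02 b hb hbγ) (l03 b hb hbγ) l05 (l06 b hb hbγ) (l07 b hb hbγ) (l08 b hb hbγ) (l09aff b hb hbγ) (l09blind b hb hbγ)
      (l09hom b hb hbγ) (l09unit b hb hbγ) hE₁ hδ hθ hθθ' hθ'1 hcH hω hρ₀ l10near hB l10first hS

/-- **BOTH W2 CLAUSES AS ONE ε₁-THRESHOLD** [bookkeeping]: for letters `0 ≤ C₃`, `0 ≤ c_H`, `0 < ω < θ′`, `ρ₀ < 1` (and the signs ∕ reach clause
of the END) there is `ε⋆ > 0` — `EnvelopeOnRecord.eps_threshold_record`'s explicit minimum in the located numerals — such that for EVERY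
`ε₁ ∈ [0, ε⋆[` and EVERY member data (step models, activities, functionals) obeying (2.13), the H-layer datum AT MAJORANT `C₃ε₁` and the leaves,
`N18At` holds with `C₅(ε₁)`: the [KP86] clause and the sharp clause are DISCHARGED by the smallness of ε₁ (the data may depend on ε₁ — they are
quantified after it). [cite: Balaban1988RG2Cluster, Lemma 3 (2.38)–(2.40) p.20] -/
theorem n18At_of_envelopeOnRecord_eps {W : Set (ℕ → ℝ)} {γ C3 Rd κ EA₀ E₀ E₁ δ δ' θ θ' cH ω ρ₀ B : ℝ} {k₀ : ℕ}
    (hC3 : 0 ≤ C3) (hκ : 0 ≤ κ) (hrate : κ + 2 * (64 * Real.log 162) + 2 ≤ Rd)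
    (hE₁ : 0 < E₁) (hδ : 0 ≤ δ + δ') (hθ : 0 ≤ θ) (hθθ' : θ ≤ θ') (hθ'1 : θ' ≤ 1) (hcH : 0 ≤ cH) (hω : 0 < ω) (hωθ' : ω < θ')
    (hρ₀ : ρ₀ < 1) (l10near : (δ + δ') * θ ^ k₀ + cH * (EA₀ + E₀) / (1 - ω) ≤ ρ₀) (hB : 0 ≤ B)
    (l10first : ∀ k < k₀, EA₀ + E₀ ≤ B * θ ^ k) (Λ : ℕ → ℕ → ℝ) (C₉ ωm cr ρ : ℝ) :
    ∃ εs : ℝ, 0 < εs ∧ ∀ ε₁ : ℝ, 0 ≤ ε₁ → ε₁ < εs →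
      ∀ (M : ℝ → StepModel Rr.carriers Op Hist) (act : ℝ → (j : ℕ) → Op × Hist → TDom 4 (Rr.cubesPerDir j) → ℂ)
        (EA : Functional Rr.carriers Rr.carriers.BgA) (EB : ℝ → Functional Rr.carriers Rr.carriers.BgB),
        (∀ b : ℝ, 0 < b → b ≤ γ → ∀ (X : Rr.carriers.Dom) (z : Op × Hist),
          (M b).Out X.1 z.1 z.2 X =
            locE (TTouch (d := 4) (N := Rr.cubesPerDir X.1)) (fun Z : (tsys 4 (Rr.cubesPerDir X.1)).Dom => Z.1) (act b X.1 z)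
              X.2.1) →
        (∀ b : ℝ, 0 < b → b ≤ γ → ∀ j, ∀ g ∈ W, ∀ (U : Rr.carriers.BgB) (p : Op × Hist), p ∈ (M b).Base j g U →
          ∃ V : Set (Op × Hist), IsOpen V ∧ (M b).box j p ⊆ V ∧
            (∀ Z : TDom 4 (Rr.cubesPerDir j), DifferentiableOn ℂ (fun z : Op × Hist => act b j z Z) V) ∧
            (∀ z ∈ V, ∀ Z : TDom 4 (Rr.cubesPerDir j), ‖act b j z Z‖ ≤ C3 * ε₁ * Real.exp (-(Rd * torusTreeLen Z.1)))) →
        (∀ b : ℝ, 0 < b → b ≤ γ → L01 (M b) EA W) → (∀ b : ℝ, 0 < b → b ≤ γ → L02 (M b) (EB b) W) →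
        (∀ b : ℝ, 0 < b → b ≤ γ → L03 (M b) (EB b) W) → L05 EA W EA₀ κ → (∀ b : ℝ, 0 < b → b ≤ γ → L06 (EB b) W E₀ κ) →
        (∀ b : ℝ, 0 < b → b ≤ γ → L07 (M b) W δ θ) → (∀ b : ℝ, 0 < b → b ≤ γ → L08 (M b) W κ E₀ δ' θ) →
        (∀ b : ℝ, 0 < b → b ≤ γ → L09aff (M b) W) → (∀ b : ℝ, 0 < b → b ≤ γ → L09blind (M b) W) →
        (∀ b : ℝ, 0 < b → b ≤ γ → L09hom (M b) W) → (∀ b : ℝ, 0 < b → b ≤ γ → L09unit (M b) W κ E₁ cH ω) →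
        N18At ⟨Rr.carriers, W, γ, κ, EA, EB, θ',
          (Real.exp 1 * 9 * 64 * K₀ 64 8 ^ 2 * (C3 * ε₁) / (1 - ρ₀) * (δ + δ') + B) * (θ' - ω) /
            (θ' - (ω + Real.exp 1 * 9 * 64 * K₀ 64 8 ^ 2 * (C3 * ε₁) / (1 - ρ₀) * cH)), Λ, C₉, ωm, cr, ρ⟩ := by
  obtain ⟨εs, hεs, hthr⟩ := eps_threshold_record (κ := κ) hC3 hcH hωθ' hρ₀
  refine ⟨εs, hεs, fun ε₁ hε₁ hε₁s M act EA EB hrep hH l01 l02 l03 l05 l06 l07 l08 l09aff l09blind l09hom l09unit => ?_⟩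
  obtain ⟨hKP, hS⟩ := hthr ε₁ hε₁s
  exact n18At_of_envelopeOnRecord Rr M hrep hC3 hε₁ hκ hrate hKP hH l01 l02 l03 l05 l06 l07 l08 l09aff l09blind l09hom l09unit hE₁
    hδ hθ hθθ' hθ'1 hcH hω hρ₀ l10near hB l10first hS Λ C₉ ωm cr ρ

end Face

/-- **`N18At` PULLS BACK ALONG MAPS OF CARRIERS** [bookkeeping] (`N18Knit.ne5_family_comap` in the route's vocabulary): along any maps of
domains and backgrounds `C′ → C` preserving the scale and the tree length and commuting with the transports, `N18At` at a bundle on `C` gives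
`N18At` at the bundle on `C′` whose functionals READ THROUGH the maps — same window, radius, `κ`, `θ`, `C₅` (NE9 ∕ read-out letters free).  This is
how a rate-record home whose U3 carriers are NOT literally `TwoRuns.carriers` (e.g. the level-`K` pair carriers of a tower of carriers,
`Spine/NE9/TowerCarriers.TowerData.level`) still takes N18 from the H-layer END of §1: exhibit the three compatibilities. [folklore] -/
theorem n18At_comap {C C' : Carriers} (φD : C'.Dom → C.Dom) (φA : C'.BgA → C.BgA) (φB : C'.BgB → C.BgB)
    (hscale : ∀ X, C.scale (φD X) = C'.scale X) (hd : ∀ X, C.d (φD X) = C'.d X)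
    (htr : ∀ U, φA (C'.transport U) = C.transport (φB U))
    {W : Set (ℕ → ℝ)} {γ κ : ℝ} {EA : Functional C C.BgA} {EB : ℝ → Functional C C.BgB} {θ C₅ : ℝ} {Λ : ℕ → ℕ → ℝ}
    {C₉ ωm cr ρ : ℝ} (h : N18At ⟨C, W, γ, κ, EA, EB, θ, C₅, Λ, C₉, ωm, cr, ρ⟩) (Λ' : ℕ → ℕ → ℝ) (C₉' ωm' cr' ρ' : ℝ) :
    N18At ⟨C', W, γ, κ, fun g U X => EA g (φA U) (φD X), fun b g U X => EB b g (φB U) (φD X), θ, C₅, Λ', C₉', ωm', cr', ρ'⟩ :=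
  ne5_family_comap φD φA φB hscale hd htr h

/-! ## §2 `S_N18 RRec` for EVERY rate-record predicate whose bundles of record carry the H-layer slot -/

variable {N : ℕ} [NeZero N]

/-- **`S_N18 RRec` FOR EVERY RATE-RECORD PREDICATE WHOSE BUNDLES READ, THROUGH MAPS OF CARRIERS, A BUNDLE CARRYING `N18At`** [bookkeeping] —
the carrier-generic form of the (W2) closer: the clause is «there are a U3 bundle `u` with `N18At u` (e.g. the H-layer bundle of
`n18At_of_envelopeOnRecord`, the primitive-rate bundle of `BalabanUVNodesN18AtRecord.n18At_of_primitiveRate`, King's model bundle) and maps of the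
record's U3 carriers into `u.C` preserving scale ∕ tree length and commuting with the transports, and `R.u3` IS the pulled-back bundle at the SAME
window, radius, `κ`, `θ`, `C₅`».  ONE application at a rate-record home whose carriers of record are a refinement ∕ re-indexing of the END's.
[folklore] -/
theorem s_N18_of_comap (RRec : RateRecordPred N)
    (h : ∀ (F : T4Family) (D : Datum F N) (g₀ : ℕ → ℝ) (os : List (ULoop F)) (R : RateCarriers N), RRec F D g₀ os R →
      ∃ (u : U3Carriers) (C' : Carriers) (φD : C'.Dom → u.C.Dom) (φA : C'.BgA → u.C.BgA) (φB : C'.BgB → u.C.BgB)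
        (Λ' : ℕ → ℕ → ℝ) (C₉' ωm' cr' ρ' : ℝ),
        (∀ X, u.C.scale (φD X) = C'.scale X) ∧ (∀ X, u.C.d (φD X) = C'.d X) ∧ (∀ U, φA (C'.transport U) = u.C.transport (φB U)) ∧
        N18At u ∧
        R.u3 = ⟨C', u.W, u.γ, u.κ, fun g U X => u.EA g (φA U) (φD X), fun b g U X => u.EB b g (φB U) (φD X), u.θ, u.C₅, Λ', C₉', ωm',
          cr', ρ'⟩) :
    S_N18 RRec := by
  intro F D g₀ os R hR
  obtain ⟨u, C', φD, φA, φB, Λ', C₉', ωm', cr', ρ', hscale, hd, htr, hu, hR3⟩ := h F D g₀ os R hR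
  rw [hR3]
  obtain ⟨C, W, γ, κ, EA, EB, θ, C₅, Λ, C₉, ωm, cr, ρ⟩ := u
  exact n18At_comap φD φA φB hscale hd htr hu Λ' C₉' ωm' cr' ρ'

open Classical in
/-- **`S_N18 RRec` FOR EVERY RATE-RECORD PREDICATE WHOSE BUNDLES OF RECORD CARRY THE H-LAYER SLOT** [bookkeeping] — the refinement-generic
closer of the K4 stub through row NE5's H-layer END (nothing closed over an unpinned bundle, R422): the hypothesis is ONE clause the instancing
predicate can carry — «`R.u3` IS the bundle `⟨Rr.carriers, W, γ, κ, EA, EB, θ′, C₅, …⟩` of a two-run datum `Rr` on some gauge group, with per-member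
step models whose output is (2.13) of activities carrying the NODE-A majorant `C₃ε₁·e^{−R_d·d}` near the admissible boxes, the leaves and the located
numerals» — whose content is NODE A's (2.38) for Bałaban's (2.14)-term activities, NODE O's one-step objects and rows NE2∕NE3's rates L07∕L08
instantiated on Bałaban's runs (the decidability instances of `locE` are the classical ones here).  ONE application at a rate-record home carrying
the clause; `BalabanUVNodesN18AtRecord.s_N18_of_refines` transports it to every refinement. [cite: Balaban1988RG2Cluster, Lemma 3 (2.38) p.20; Balaban1987RG1, Thm 1 p.259] -/
theorem s_N18_of_envelopeOnRecord (RRec : RateRecordPred N)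
    (h : ∀ (F : T4Family) (D : Datum F N) (g₀ : ℕ → ℝ) (os : List (ULoop F)) (R : RateCarriers N), RRec F D g₀ os R →
      ∃ (G : Type) (_ : GaugeGroup G) (Rr : TwoRuns G) (Op : Type) (_ : NormedAddCommGroup Op) (_ : NormedSpace ℂ Op)
        (Hist : Type) (_ : NormedAddCommGroup Hist) (_ : NormedSpace ℂ Hist) (M : ℝ → StepModel Rr.carriers Op Hist)
        (act : ℝ → (j : ℕ) → Op × Hist → TDom 4 (Rr.cubesPerDir j) → ℂ) (W : Set (ℕ → ℝ)) (γ C3 ε₁ Rd κ : ℝ)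
        (EA : Functional Rr.carriers Rr.carriers.BgA) (EB : ℝ → Functional Rr.carriers Rr.carriers.BgB)
        (EA₀ E₀ E₁ δ δ' θ θ' cH ω ρ₀ B : ℝ) (k₀ : ℕ) (Λ : ℕ → ℕ → ℝ) (C₉ ωm cr ρ : ℝ),
        R.u3 = ⟨Rr.carriers, W, γ, κ, EA, EB, θ',
          (Real.exp 1 * 9 * 64 * K₀ 64 8 ^ 2 * (C3 * ε₁) / (1 - ρ₀) * (δ + δ') + B) * (θ' - ω) /
            (θ' - (ω + Real.exp 1 * 9 * 64 * K₀ 64 8 ^ 2 * (C3 * ε₁) / (1 - ρ₀) * cH)), Λ, C₉, ωm, cr, ρ⟩ ∧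
        (∀ b : ℝ, 0 < b → b ≤ γ → ∀ (X : Rr.carriers.Dom) (z : Op × Hist),
          (M b).Out X.1 z.1 z.2 X =
            locE (TTouch (d := 4) (N := Rr.cubesPerDir X.1)) (fun Z : (tsys 4 (Rr.cubesPerDir X.1)).Dom => Z.1) (act b X.1 z)
              X.2.1) ∧
        0 ≤ C3 ∧ 0 ≤ ε₁ ∧ 0 ≤ κ ∧ κ + 2 * (64 * Real.log 162) + 2 ≤ Rd ∧
        C3 * ε₁ * Real.exp (5 * κ + 1) * K₀ 64 8 * 9 * 64 ≤ 1 ∧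
        (∀ b : ℝ, 0 < b → b ≤ γ → ∀ j, ∀ g ∈ W, ∀ (U : Rr.carriers.BgB) (p : Op × Hist), p ∈ (M b).Base j g U →
          ∃ V : Set (Op × Hist), IsOpen V ∧ (M b).box j p ⊆ V ∧
            (∀ Z : TDom 4 (Rr.cubesPerDir j), DifferentiableOn ℂ (fun z : Op × Hist => act b j z Z) V) ∧
            (∀ z ∈ V, ∀ Z : TDom 4 (Rr.cubesPerDir j), ‖act b j z Z‖ ≤ C3 * ε₁ * Real.exp (-(Rd * torusTreeLen Z.1)))) ∧
        (∀ b : ℝ, 0 < b → b ≤ γ → L01 (M b) EA W) ∧ (∀ b : ℝ, 0 < b → b ≤ γ → L02 (M b) (EB b) W) ∧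
        (∀ b : ℝ, 0 < b → b ≤ γ → L03 (M b) (EB b) W) ∧ L05 EA W EA₀ κ ∧ (∀ b : ℝ, 0 < b → b ≤ γ → L06 (EB b) W E₀ κ) ∧
        (∀ b : ℝ, 0 < b → b ≤ γ → L07 (M b) W δ θ) ∧ (∀ b : ℝ, 0 < b → b ≤ γ → L08 (M b) W κ E₀ δ' θ) ∧
        (∀ b : ℝ, 0 < b → b ≤ γ → L09aff (M b) W) ∧ (∀ b : ℝ, 0 < b → b ≤ γ → L09blind (M b) W) ∧
        (∀ b : ℝ, 0 < b → b ≤ γ → L09hom (M b) W) ∧ (∀ b : ℝ, 0 < b → b ≤ γ → L09unit (M b) W κ E₁ cH ω) ∧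
        0 < E₁ ∧ 0 ≤ δ + δ' ∧ 0 ≤ θ ∧ θ ≤ θ' ∧ θ' ≤ 1 ∧ 0 ≤ cH ∧ 0 < ω ∧ ρ₀ < 1 ∧
        (δ + δ') * θ ^ k₀ + cH * (EA₀ + E₀) / (1 - ω) ≤ ρ₀ ∧ 0 ≤ B ∧ (∀ k < k₀, EA₀ + E₀ ≤ B * θ ^ k) ∧
        Real.exp 1 * 9 * 64 * K₀ 64 8 ^ 2 * C3 * cH * ε₁ < (θ' - ω) * (1 - ρ₀)) :
    S_N18 RRec := by
  intro F D g₀ os R hR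
  obtain ⟨G, _, Rr, Op, _, _, Hist, _, _, M, act, W, γ, C3, ε₁, Rd, κ, EA, EB, EA₀, E₀, E₁, δ, δ', θ, θ', cH, ω, ρ₀, B, k₀, Λ, C₉,
    ωm, cr, ρ, hu, hrep, hC3, hε₁, hκ, hrate, hKP, hH, l01, l02, l03, l05, l06, l07, l08, l09aff, l09blind, l09hom, l09unit, hE₁, hδ,
    hθ, hθθ', hθ'1, hcH, hω, hρ₀, l10near, hB, l10first, hS⟩ := h F D g₀ os R hR
  rw [hu]
  exact n18At_of_envelopeOnRecord Rr M hrep hC3 hε₁ hκ hrate hKP hH l01 l02 l03 l05 l06 l07 l08 l09aff l09blind l09hom l09unit hE₁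
    hδ hθ hθθ' hθ'1 hcH hω hρ₀ l10near hB l10first hS Λ C₉ ωm cr ρ

/-! ## §3 The datum key: the two-run carriers built from the record's datum; their transport at a Stage-11 record -/

open Classical in
/-- **`S_N18 RRec` KEYED TO THE DATUM** [bookkeeping] — §2 with the two-run datum BUILT FROM THE RECORD's DATUM `D : Datum F N`: the torus family of
the record `F`, a number of steps `K` (run A = `F.P K`, run B = `F.P (K+1)`), a big-cube exponent `m′`, the DATUM's OWN one-step averaging
`D.av (K+1) 0` on run B's finest lattice as the transport (+ the level identification), admissible classes `admA ∕ admB` mapped into each other: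
`Rr := ⟨F, K, m′, D.av (K+1) 0, admA, admB, hmaps⟩ : TwoRuns (SU N)`.  This is the clause a rate-record home keyed to NODE 00's record can carry for
N18 through the H-layer END; `datumCarriers_transport_of_isRecordOfRecord₁₁C` reads its transport at a Stage-11 record.
[cite: Balaban1987RG1, (0.4) p.253 and (0.24) p.257; Balaban1988RG2Cluster, Lemma 3 (2.38) p.20] -/
theorem s_N18_datum_of_envelopeOnRecord (RRec : RateRecordPred N)
    (h : ∀ (F : T4Family) (D : Datum F N) (g₀ : ℕ → ℝ) (os : List (ULoop F)) (R : RateCarriers N), RRec F D g₀ os R →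
      ∃ (K m' : ℕ) (admA : Set (GaugeField (F.P K) 0 (Node00.SU N))) (admB : Set (GaugeField (F.P (K + 1)) 0 (Node00.SU N)))
        (hmaps : Set.MapsTo (transportRaw F K (D.av (K + 1) 0)) admB admA)
        (Op : Type) (_ : NormedAddCommGroup Op) (_ : NormedSpace ℂ Op) (Hist : Type) (_ : NormedAddCommGroup Hist) (_ : NormedSpace ℂ Hist)
        (M : ℝ → StepModel (⟨F, K, m', D.av (K + 1) 0, admA, admB, hmaps⟩ : TwoRuns (Node00.SU N)).carriers Op Hist)
        (act : ℝ → (j : ℕ) → Op × Hist → TDom 4 ((⟨F, K, m', D.av (K + 1) 0, admA, admB, hmaps⟩ : TwoRuns (Node00.SU N)).cubesPerDir j) → ℂ)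
        (W : Set (ℕ → ℝ)) (γ C3 ε₁ Rd κ : ℝ)
        (EA : Functional (⟨F, K, m', D.av (K + 1) 0, admA, admB, hmaps⟩ : TwoRuns (Node00.SU N)).carriers
          (⟨F, K, m', D.av (K + 1) 0, admA, admB, hmaps⟩ : TwoRuns (Node00.SU N)).carriers.BgA)
        (EB : ℝ → Functional (⟨F, K, m', D.av (K + 1) 0, admA, admB, hmaps⟩ : TwoRuns (Node00.SU N)).carriers
          (⟨F, K, m', D.av (K + 1) 0, admA, admB, hmaps⟩ : TwoRuns (Node00.SU N)).carriers.BgB)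
        (EA₀ E₀ E₁ δ δ' θ θ' cH ω ρ₀ B : ℝ) (k₀ : ℕ) (Λ : ℕ → ℕ → ℝ) (C₉ ωm cr ρ : ℝ),
        R.u3 = ⟨(⟨F, K, m', D.av (K + 1) 0, admA, admB, hmaps⟩ : TwoRuns (Node00.SU N)).carriers, W, γ, κ, EA, EB, θ',
          (Real.exp 1 * 9 * 64 * K₀ 64 8 ^ 2 * (C3 * ε₁) / (1 - ρ₀) * (δ + δ') + B) * (θ' - ω) /
            (θ' - (ω + Real.exp 1 * 9 * 64 * K₀ 64 8 ^ 2 * (C3 * ε₁) / (1 - ρ₀) * cH)), Λ, C₉, ωm, cr, ρ⟩ ∧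
        (∀ b : ℝ, 0 < b → b ≤ γ → ∀ (X : (⟨F, K, m', D.av (K + 1) 0, admA, admB, hmaps⟩ : TwoRuns (Node00.SU N)).carriers.Dom)
            (z : Op × Hist),
          (M b).Out X.1 z.1 z.2 X =
            locE (TTouch (d := 4) (N := (⟨F, K, m', D.av (K + 1) 0, admA, admB, hmaps⟩ : TwoRuns (Node00.SU N)).cubesPerDir X.1))
              (fun Z : (tsys 4 ((⟨F, K, m', D.av (K + 1) 0, admA, admB, hmaps⟩ : TwoRuns (Node00.SU N)).cubesPerDir X.1)).Dom => Z.1)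
              (act b X.1 z) X.2.1) ∧
        0 ≤ C3 ∧ 0 ≤ ε₁ ∧ 0 ≤ κ ∧ κ + 2 * (64 * Real.log 162) + 2 ≤ Rd ∧
        C3 * ε₁ * Real.exp (5 * κ + 1) * K₀ 64 8 * 9 * 64 ≤ 1 ∧
        (∀ b : ℝ, 0 < b → b ≤ γ → ∀ j, ∀ g ∈ W,
          ∀ (U : (⟨F, K, m', D.av (K + 1) 0, admA, admB, hmaps⟩ : TwoRuns (Node00.SU N)).carriers.BgB) (p : Op × Hist),
          p ∈ (M b).Base j g U →
          ∃ V : Set (Op × Hist), IsOpen V ∧ (M b).box j p ⊆ V ∧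
            (∀ Z : TDom 4 ((⟨F, K, m', D.av (K + 1) 0, admA, admB, hmaps⟩ : TwoRuns (Node00.SU N)).cubesPerDir j),
              DifferentiableOn ℂ (fun z : Op × Hist => act b j z Z) V) ∧
            (∀ z ∈ V, ∀ Z : TDom 4 ((⟨F, K, m', D.av (K + 1) 0, admA, admB, hmaps⟩ : TwoRuns (Node00.SU N)).cubesPerDir j),
              ‖act b j z Z‖ ≤ C3 * ε₁ * Real.exp (-(Rd * torusTreeLen Z.1)))) ∧
        (∀ b : ℝ, 0 < b → b ≤ γ → L01 (M b) EA W) ∧ (∀ b : ℝ, 0 < b → b ≤ γ → L02 (M b) (EB b) W) ∧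
        (∀ b : ℝ, 0 < b → b ≤ γ → L03 (M b) (EB b) W) ∧ L05 EA W EA₀ κ ∧ (∀ b : ℝ, 0 < b → b ≤ γ → L06 (EB b) W E₀ κ) ∧
        (∀ b : ℝ, 0 < b → b ≤ γ → L07 (M b) W δ θ) ∧ (∀ b : ℝ, 0 < b → b ≤ γ → L08 (M b) W κ E₀ δ' θ) ∧
        (∀ b : ℝ, 0 < b → b ≤ γ → L09aff (M b) W) ∧ (∀ b : ℝ, 0 < b → b ≤ γ → L09blind (M b) W) ∧
        (∀ b : ℝ, 0 < b → b ≤ γ → L09hom (M b) W) ∧ (∀ b : ℝ, 0 < b → b ≤ γ → L09unit (M b) W κ E₁ cH ω) ∧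
        0 < E₁ ∧ 0 ≤ δ + δ' ∧ 0 ≤ θ ∧ θ ≤ θ' ∧ θ' ≤ 1 ∧ 0 ≤ cH ∧ 0 < ω ∧ ρ₀ < 1 ∧
        (δ + δ') * θ ^ k₀ + cH * (EA₀ + E₀) / (1 - ω) ≤ ρ₀ ∧ 0 ≤ B ∧ (∀ k < k₀, EA₀ + E₀ ≤ B * θ ^ k) ∧
        Real.exp 1 * 9 * 64 * K₀ 64 8 ^ 2 * C3 * cH * ε₁ < (θ' - ω) * (1 - ρ₀)) :
    S_N18 RRec := by
  refine s_N18_of_envelopeOnRecord RRec fun F D g₀ os R hR => ?_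
  obtain ⟨K, m', admA, admB, hmaps, Op, _, _, Hist, _, _, M, act, W, γ, C3, ε₁, Rd, κ, EA, EB, EA₀, E₀, E₁, δ, δ', θ, θ', cH, ω, ρ₀,
    B, k₀, Λ, C₉, ωm, cr, ρ, hu, hrest⟩ := h F D g₀ os R hR
  exact ⟨Node00.SU N, inferInstance, ⟨F, K, m', D.av (K + 1) 0, admA, admB, hmaps⟩, Op, inferInstance, inferInstance, Hist,
    inferInstance, inferInstance, M, act, W, γ, C3, ε₁, Rd, κ, EA, EB, EA₀, E₀, E₁, δ, δ', θ, θ', cH, ω, ρ₀, B, k₀, Λ, C₉, ωm, cr, ρ,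
    hu, hrest⟩

/-- **AT A STAGE-11 RECORD THE DATUM-KEYED TRANSPORT IS BAŁABAN's (0.4) BLOCK AVERAGING** [bookkeeping]: for `Node00.IsRecordOfRecord₁₁C F N D w`
(the route's K3 binder) the record's datum is a datum of record, Stage 0 (`Node00.isDatumOfRecord₀_of_isRecordOfRecord₁₁C`: `D.av = avOfRecord F N`
= `blockAvg expMeanLogSU` at every torus and level), so the run B → run A transport of the datum-keyed carriers of `s_N18_datum_of_envelopeOnRecord` —
by `TwoRuns.carriers_transport_val` the raw transport `transportRaw F K (D.av (K+1) 0)` — IS `transportRaw F K (blockAvg expMeanLogSU)`: run B's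
admissible background is seen by run A through the printed centred block averaging with inner operation exp[mean log] on `SU(N)`, followed by the
level identification.  What `N18At` at such a bundle then compares is `E^A(g, M̄(U), X)` with `E^B_b(g, U, X)` for THIS `M̄`.
[cite: Balaban1987RG1, (0.4) p.253] -/
theorem datumCarriers_transport_of_isRecordOfRecord₁₁C {F : T4Family} {D : Datum F N} {w : DagBinding.WorldP}
    (hR : Node00.IsRecordOfRecord₁₁C F N D w) (K m' : ℕ) (admA : Set (GaugeField (F.P K) 0 (Node00.SU N)))
    (admB : Set (GaugeField (F.P (K + 1)) 0 (Node00.SU N))) (hmaps : Set.MapsTo (transportRaw F K (D.av (K + 1) 0)) admB admA)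
    (U : (⟨F, K, m', D.av (K + 1) 0, admA, admB, hmaps⟩ : TwoRuns (Node00.SU N)).carriers.BgB) :
    ((⟨F, K, m', D.av (K + 1) 0, admA, admB, hmaps⟩ : TwoRuns (Node00.SU N)).carriers.transport U).1 =
      transportRaw F K (BlockAveraging.blockAvg ExpMeanLog.expMeanLogSU) U.1 := by
  have hD0 : D.av = Node00.avOfRecord F N := Node00.isDatumOfRecord₀_of_isRecordOfRecord₁₁C hR
  have h2 : transportRaw F K (D.av (K + 1) 0) = transportRaw F K (BlockAveraging.blockAvg ExpMeanLog.expMeanLogSU) := by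
    rw [hD0]; rfl
  exact (TwoRuns.carriers_transport_val _ U).trans (congrFun h2 U.1)

/-! ## §4 Inhabited with content: the §1 bundle shape holds on every pair of runs for the witness model's recursive outputs -/

/-- **THE H-LAYER BUNDLE SHAPE IS INHABITED WITH CONTENT ON EVERY PAIR OF RUNS** [decided witness, by name]: for every two-run datum `Rr`, window
`W`, radius `γ`, decay `κ ≥ 0` and target rate `θ′ ∈ ]½, 1]` (so `θ′ < 1` is allowed) there are POSITIVE letters `a` (activity constant), `δ`
(operator separation of the runs), `c_H` (history gain) and a constant `C₅` with `N18At` at the bundle on `Rr.carriers` whose run-A functional and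
(constant) run-B family are the RECURSIVELY DEFINED outputs `recA ∕ recB` of the witness step model `EnvelopeOnRecordWitness.wModel` (nonzero
activities `a·e^{−R_d·d(Z)}` with (2.13) as the output, runs differing by exactly `δ·θ′^k` operator margins, nonzero linear history insertions) —
`EnvelopeOnRecordWitness.exists_end_fires` (the H-layer END applied with EVERY binder discharged) + `N18AtByName.n18At_of_ne5`.  A TOY on the real
carriers: nothing of Bałaban's (2.14)-term activities is modelled. [folklore] -/
theorem n18At_envelopeOnRecord_fires {G : Type} [GaugeGroup G] (Rr : TwoRuns G) [∀ j, DecidableEq (TDom 4 (Rr.cubesPerDir j))]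
    [∀ j, DecidableRel (TTouch (d := 4) (N := Rr.cubesPerDir j))] (W : Set (ℕ → ℝ)) (γ : ℝ) {κ θ' : ℝ} (hκ : 0 ≤ κ)
    (hθ' : 1 / 2 < θ') (hθ'1 : θ' ≤ 1) (Λ : ℕ → ℕ → ℝ) (C₉ ωm cr ρ : ℝ) :
    ∃ a δ cH : ℝ, 0 < a ∧ 0 < δ ∧ 0 < cH ∧ ∃ C₅ : ℝ,
      N18At ⟨Rr.carriers, W, γ, κ, recA (wModel Rr a (κ + 2 * (64 * Real.log 162) + 2) κ δ θ' cH),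
        fun _ => recB (wModel Rr a (κ + 2 * (64 * Real.log 162) + 2) κ δ θ' cH), θ', C₅, Λ, C₉, ωm, cr, ρ⟩ := by
  obtain ⟨a, δ, cH, ha, hδ, hcH, C₅, h⟩ := exists_end_fires Rr W hκ hθ' hθ'1
  exact ⟨a, δ, cH, ha, hδ, hcH, C₅, n18At_of_ne5 h γ Λ C₉ ωm cr ρ⟩

end YMDAG.N18.HLayer

end
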